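import Summits.QuantumFields.YangMills.Theses.LangevinControlUV
import Literature.MathematicalPhysics.QuantumFieldTheory.MassGapFromLatticeClustering

/-!
# Skeleton of line `Sketch` for crux `GapToContinuum` (stmt-QuantumFields-8896), lead-owned

Composition: the continuum half of the crux is ALREADY a theorem of the tree —
`IsYangMillsFor.hasMassGap_of_hasCSClustering` (`MassGapFromLatticeClustering.lean`:
convergence on off-diagonal real product tensors + `ClustersCS` of the lattice `n`-point functions
⇒ `T.HasMassGap Δ`, via `hasMassGap_of_csBound_span`: density of slab-ordered product spans in the
time-ordered test functions and E1-triviality of degree `0`).  What remains of the crux is therefore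
EXACTLY the lattice statement "`HasLatticeMassGap r sch Δ` (per-pair constants AND thresholds) ⇒
`sch.HasCSClustering r Δ` (norm-form Cauchy–Schwarz clustering of the smeared multi-leg lattice
vectors on the scheme's OWN tori, eventually in `k`, slack `ε`)", split by the sign of the coupling
(reflection positivity of Wilson's weight on the odd tori `2S+1` needs `0 ≤ β`,
`wilsonExpectation_oddReflectionPositive`):

* `stub_csClustering_of_nonnegBeta` — the case `∀ᶠ k, 0 ≤ sch.β k` (line `Sketch`'s S1–S3 + R:
  purity/heaviness of one-leg vectors, physical-scale thresholds, Reeh–Schlieder spreading);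
* `stub_csClustering_of_negBeta` — the complementary case (`β_k < 0` frequently: no transfer-matrix
  technology at all; the β-sign hole H1/F3 of both ideators).

`GapToContinuum_of` concludes the crux BY NAME from the two stubs.  See `Lines/Sketch.dead.md` for
why neither stub is derivable from the typed hypothesis.
-/

namespace Summit.QuantumFields.YangMills.Cruxes.GapToContinuum.Sketch

open Filter
open Literature.MathematicalPhysics.QuantumFieldTheory

/-- **Stub (β ≥ 0 eventually).**  Per-pair lattice clustering ⇒ norm-form Cauchy–Schwarz
clustering of the lattice `n`-point functions on the scheme's tori, when Osterwalder–Seiler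
reflection positivity is available eventually. -/
theorem stub_csClustering_of_nonnegBeta :
    ∀ (G : Type) [Group G] [TopologicalSpace G] [IsTopologicalGroup G] [CompactSpace G]
      [MeasurableSpace G] [BorelSpace G] (r : LatticeRep G) (sch : SpeciesScheme (YMSpecies G))
      (T : OSData (YMSpecies G) 4) (Δ : ℝ), 0 < Δ → (∀ᶠ k in atTop, 0 ≤ sch.β k) →
        IsYangMillsFor r sch T → HasLatticeMassGap r sch Δ → sch.HasCSClustering r Δ := by
  sorry

/-- **Stub (β < 0 frequently).**  The same conclusion without any reflection positivity. -/
theorem stub_csClustering_of_negBeta :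
    ∀ (G : Type) [Group G] [TopologicalSpace G] [IsTopologicalGroup G] [CompactSpace G]
      [MeasurableSpace G] [BorelSpace G] (r : LatticeRep G) (sch : SpeciesScheme (YMSpecies G))
      (T : OSData (YMSpecies G) 4) (Δ : ℝ), 0 < Δ → (¬ ∀ᶠ k in atTop, 0 ≤ sch.β k) →
        IsYangMillsFor r sch T → HasLatticeMassGap r sch Δ → sch.HasCSClustering r Δ := by
  sorry

/-- **Composition**: the two stubs and the tree's transfer theorem give the crux by name. -/
theorem GapToContinuum_of :
    Summit.QuantumFields.YangMills.Theses.LangevinControlUV.GapToContinuum := by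
  intro G _ _ _ _ _ _ r sch T Δ hΔ hYM hlat
  by_cases hβ : ∀ᶠ k in atTop, 0 ≤ sch.β k
  · exact hYM.hasMassGap_of_hasCSClustering
      (stub_csClustering_of_nonnegBeta G r sch T Δ hΔ hβ hYM hlat)
  · exact hYM.hasMassGap_of_hasCSClustering
      (stub_csClustering_of_negBeta G r sch T Δ hΔ hβ hYM hlat)

end Summit.QuantumFields.YangMills.Cruxes.GapToContinuum.Sketch
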